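import Literature.Geometry.Kaehler.ComplexTorusWeightCompactSupport
import Literature.Geometry.Kaehler.ComplexTorusAnalyticCycleClass
import Literature.Geometry.GeometricMeasureTheory.CurrentsSupportTheorem
import HarnessLib

/-!
# The periods of a periodic holomorphic chain as values of its current; weak limits

Layer `Literature/Geometry/Kaehler`; lane `lit-hodgefound`, seat p07, programme «BOUNDED CYCLES ON A
COMPLEX TORUS», file 1. Let `X = E/Λ`, `Λ = Φ(ℤ^ι)`, be a complex torus and `T` a holomorphic
`p`-chain on `E` (`p = q + 1`) with `Λ`-periodic carrier `reg|T|` and density `θ_T` periodic on it —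
the shape of the lift `π^* Z` of an analytic cycle `Z` of `X` (`ComplexTorusChainPeriods.lean`,
`ComplexTorusAnalyticCycleClass.lean`). Its period functional `η ↦ ∫_{T/Λ} η` on the invariant forms
`Alt^{2p}_ℝ(E; ℂ) = H^{2p}(X, ℂ)` (`HolomorphicChain.torusPeriod`: the integral over the period box
`Φ([0,1)^ι)`) is NOT literally a value of the current `[T]` (the box is not a test form). This file
rewrites it as one: with the smooth FUNDAMENTAL WEIGHT `w = Π_i ψ(x_i)` of `Λ`
(`ComplexTorus.weight Φ univ`, `Σ_{λ ∈ Λ} w(x + λ) = 1`, compact support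
`ComplexTorus.hasCompactSupport_weight_univ`; [Federer1969, 4.1.7]) — a test function
(`ComplexTorus.exists_testFunction_eq_weight`; the statements take any test function `χ` equal to `w`),

* `HolomorphicChain.setIntegral_periodBox_density_mul_eq_toCurrent` —
  **`∫_{Φ([0,1)^ι)} θ_T φ(ξ_T) d𝓗^{2p} = [T](w φ)`** for every constant real `2p`-form `φ` (UNFOLDING the
  `Λ`-invariant measure `θ_T 𝓗^{2p} ⌞ reg|T|` over the fundamental domain, Mathlib's
  `IsAddFundamentalDomain.integral_eq_tsum`, as in `ComplexTorusChainPeriodicStokes.lean` /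
  `ComplexTorusWeightIntegral.lean`);
* `HolomorphicChain.torusPeriod_ofReal_eq_toCurrent`, `HolomorphicChain.torusPeriod_eq_toCurrent` —
  **`∫_{T/Λ} η = [T](w · Re η) + i [T](w · Im η)`**; for analytic subsets `Z ⊆ X` of pure dimension
  `p`: `ComplexTorus.analyticCyclePeriod_eq_toCurrent` (`∫_Z η` as a value of the current `[π⁻¹ Z]`);

and draws the consequence for WEAK LIMITS [Chirka1989, §16.1; Fujiki1978, §2]: the period
functionals, hence the pairings with the classes `[Z] ∈ H^{2 codim}(X, ℂ)`, are continuous along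
sequences of periodic chains / analytic subsets whose currents converge —

* `HolomorphicChain.tendsto_torusPeriod_of_tendsto_current` — if `[T_j] → S` in the sense of currents
  (the `T_j` periodic) then `∫_{T_j/Λ} η → S(w Re η) + i S(w Im η)`;
  `HolomorphicChain.tendsto_torusPeriod_of_tendsto` — `→ ∫_{T/Λ} η` when `S = [T]`, `T` periodic;
* `ComplexTorus.tendsto_analyticCyclePeriod_of_tendsto`, `ComplexTorus.tendsto_poincarePairing_analyticCycleClass_of_tendsto`
  — for analytic subsets `Z_j, Z ⊆ X` of pure dimension `p` with `[π⁻¹ Z_j] → [π⁻¹ Z]`: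
  `∫_{Z_j} η → ∫_Z η` and `⟨γ, [Z_j]⟩ → ⟨γ, [Z]⟩` for all invariant `γ`.

Theorems only; no new definitions, no named facts.

## References

* [Federer1969] H. Federer, *Geometric Measure Theory*, Springer 1969, 4.1.7.
* [Lange2023AbelianVarietiesComplex] H. Lange, *Abelian Varieties over the Complex Numbers*, Springer
  2023, §1.1.1, §1.1.4.
* [VoisinHodgeI2002] C. Voisin, *Hodge Theory and Complex Algebraic Geometry I*, CUP 2002, §11.1.2
  Cor. 11.15, Thm. 11.21.
* [Chirka1989] E. M. Chirka, *Complex Analytic Sets*, Kluwer 1989, §14.1 Cor. (p. 174), §16.1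
  (pp. 206–207).
* [Fujiki1978] A. Fujiki, *Closedness of the Douady spaces of compact Kähler spaces*, Publ. RIMS 14
  (1978) 1–52, §2 (continuity of the currents of a convergent sequence of cycles, Prop. 2.10).
-/

noncomputable section

open scoped Manifold ENNReal NNReal Topology ContDiff Distributions
open MeasureTheory TopologicalSpace Set Function Filter Complex
open Literature.Geometry.GeometricMeasureTheory

namespace Literature.Geometry.Kaehler

-- Nested operator-norm instances on `Covector V m` / `Multivector V m`, as in `Currents.lean`.
set_option maxSynthPendingDepth 2

universe u

/-! ## §1. The fundamental weight of `Λ` is a test function -/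

namespace ComplexTorus

section Weight

variable {ι : Type*} [Fintype ι] {E : Type u} [NormedAddCommGroup E] [InnerProductSpace ℂ E]
  (Φ : (ι → ℝ) ≃L[ℝ] E)

/-- The slab over ALL coordinate directions is the period box (a private copy of the lemma of
`SiegelTorusThetaDivisorCroftonJensen.lean`, to keep the imports light). [cite: Lange2023AbelianVarietiesComplex, §1.1.1] -/
private theorem slab_univ_eq_periodBox_aux (a : ι → ℝ) : slab Φ Finset.univ a = periodBox Φ a := by
  ext x
  rw [mem_slab_iff, mem_periodBox_iff]
  simp

/-- The full fundamental weight `w = Π_i ψ(x_i)` vanishes off the coordinate box `{x_i ∈ [-1, 3]}`.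
[cite: Federer1969, 4.1.7] -/
theorem weight_univ_eq_zero_of_notMem_coordBox {x : E}
    (hx : x ∉ HolomorphicChain.coordBox Φ Finset.univ 0) : weight Φ Finset.univ x = 0 := by
  by_contra h
  apply hx
  refine ⟨fun k hk ↦ ?_, fun i hi ↦ absurd (Finset.mem_univ i) hi⟩
  have h2 := mem_Ioo_of_weight_ne_zero Φ Finset.univ h hk
  exact ⟨by linarith [h2.1], by linarith [h2.2]⟩

/-- **The fundamental weight of `Λ` is a test function**: there is `w ∈ 𝓓(E)` with
`w(x) = Π_i ψ(x_i)` (smooth, compactly supported, `Σ_{λ ∈ Λ} w(x + λ) = 1`). The statements below take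
any test function `χ` agreeing with the weight pointwise. [cite: Federer1969, 4.1.7] -/
theorem exists_testFunction_eq_weight :
    ∃ χ : 𝓓((⊤ : Opens E), ℝ), ∀ x, χ x = weight Φ Finset.univ x :=
  ⟨⟨weight Φ Finset.univ, contDiff_weight Φ Finset.univ, hasCompactSupport_weight_univ Φ, by simp⟩,
    fun _ ↦ rfl⟩

/-- A complex constant form is `Re η + i Im η` (plumbing). [folklore] -/
private theorem form_eq_re_add_im {k : ℕ} (η : E [⋀^Fin k]→L[ℝ] ℂ) :
    η = ofRealCLM.compContinuousAlternatingMap (reCLM.compContinuousAlternatingMap η) +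
      I • ofRealCLM.compContinuousAlternatingMap (imCLM.compContinuousAlternatingMap η) := by
  ext v
  simp only [ContinuousAlternatingMap.add_apply, ContinuousAlternatingMap.smul_apply,
    ContinuousLinearMap.compContinuousAlternatingMap_coe, Function.comp_apply, ofRealCLM_apply,
    reCLM_apply, imCLM_apply, smul_eq_mul]
  rw [mul_comm]
  exact (re_add_im (η v)).symm

end Weight

end ComplexTorus

/-! ## §2. The period over the box is a value of the current -/

namespace HolomorphicChain

section PeriodAsCurrent

variable {ι : Type*} [Fintype ι] [DecidableEq ι] {E : Type u} [NormedAddCommGroup E]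
  [InnerProductSpace ℂ E] [FiniteDimensional ℂ E] [MeasurableSpace E] [BorelSpace E]
  (Φ : (ι → ℝ) ≃L[ℝ] E) {q : ℕ} {χ : 𝓓((⊤ : Opens E), ℝ)}

/-- **`∫_{Φ([0,1)^ι)} θ_T φ(ξ_T) d𝓗^{2p} = [T](w φ)`.** For a holomorphic `p`-chain `T` on `E`
(`p = q + 1`) with `Λ`-periodic carrier and density periodic on it, a constant real `2p`-form `φ` and
a test function `χ` equal to the fundamental weight `w` of `Λ`, the period over the period box equals
the value of the current `[T]` on the test form `χ φ`: unfold `∫ w θ φ(ξ) d(𝓗^{2p} ⌞ reg|T|)` over the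
fundamental domain `Φ([0,1)^ι)` of `Λ` (the measure and `θ φ(ξ)` are `Λ`-invariant) and use
`Σ_λ w(x + λ) = 1`. [cite: Lange2023AbelianVarietiesComplex, §1.1.4; Federer1969, 4.1.7] -/
theorem setIntegral_periodBox_density_mul_eq_toCurrent (T : HolomorphicChain 𝓘(ℂ, E) (⊤ : Opens E) (q + 1))
    (hcar : ∀ (m : ι → ℤ) (x : E), ComplexTorus.latticeVec Φ m + x ∈ T.carrier ↔ x ∈ T.carrier)
    (hdens : ∀ (m : ι → ℤ), ∀ x ∈ T.carrier,
      T.density (ComplexTorus.latticeVec Φ m + x) = T.density x)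
    (hχ : ∀ x, χ x = ComplexTorus.weight Φ Finset.univ x)
    (φ : E [⋀^Fin (2 * (q + 1))]→L[ℝ] ℝ) :
    ∫ x in ComplexTorus.periodBox Φ 0, (T.density x : ℝ) * φ (T.orientationFrame x)
        ∂((μHE[2 * (q + 1)] : Measure E).restrict T.carrier) =
      T.toCurrent (smulCovectorCLM φ χ) := by
  letI : InnerProductSpace ℝ E := InnerProductSpace.complexToReal
  -- ### notation
  set μ : Measure E := (μHE[2 * (q + 1)] : Measure E).restrict T.carrier with hμ
  set K : Finset ι := Finset.univ with hK
  set w : E → ℝ := ComplexTorus.weight Φ K with hw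
  set D : Set E := ComplexTorus.slab Φ K 0 with hD
  set Q : Set E := coordBox Φ K 0 with hQ
  have hwC : ContDiff ℝ ∞ w := ComplexTorus.contDiff_weight Φ K
  have hQc : IsCompact Q := isCompact_coordBox Φ K 0
  have hDm : MeasurableSet D := ComplexTorus.measurableSet_slab Φ K 0
  have hcarm : MeasurableSet T.carrier := T.isRectifiableData.1
  haveI : VAddInvariantMeasure (ComplexTorus.coordSubLattice Φ K) E μ :=
    T.vaddInvariantMeasure_coordSubLattice Φ K hcar
  -- the integrand `F = θ φ(ξ)` and the weighted integrand `f = w F`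
  set F : E → ℝ := fun x ↦ (T.density x : ℝ) * φ (T.orientationFrame x) with hF
  set f : E → ℝ := fun x ↦ w x * F x with hf
  -- ### the right-hand side is `∫ f dμ`
  have hRHS : T.toCurrent (smulCovectorCLM φ χ) = ∫ x, f x ∂μ := by
    rw [toCurrent_def, currentOfIntegration_apply T.locallyIntegrableOn_density_smul_frameVector]
    refine integral_congr_ae (ae_of_all _ fun x ↦ ?_)
    simp only [smulCovectorCLM_apply, hχ, ContinuousAlternatingMap.smul_apply, smul_eq_mul, hf, hF,
      hw, hK]
    ring
  -- ### supports and integrability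
  have hw_off : ∀ x, x ∉ Q → w x = 0 := fun x hx ↦
    ComplexTorus.weight_univ_eq_zero_of_notMem_coordBox Φ hx
  have hDQ : D ⊆ Q := by
    intro x hx
    refine ⟨fun k hk ↦ ?_, fun i hi ↦ absurd (Finset.mem_univ i) hi⟩
    have h := hx k hk
    simp only [Pi.zero_apply, zero_add, mem_Ico] at h
    exact ⟨by linarith [h.1], by linarith [h.2]⟩
  have hFQ : IntegrableOn F Q μ :=
    T.integrableOn_density_mul_apply_of_isCompact hQc (η := fun _ ↦ φ) continuous_const
  have hFD : IntegrableOn F D μ := hFQ.mono_set hDQ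
  have hfQ : IntegrableOn f Q μ := by
    have h : IntegrableOn (fun y ↦ (T.density y : ℝ) * (w y • φ) (T.orientationFrame y)) Q μ :=
      T.integrableOn_density_mul_apply_of_isCompact hQc (hwC.continuous.smul continuous_const)
    refine h.congr_fun (fun y _ ↦ ?_) hQc.isClosed.measurableSet
    simp only [hf, hF, ContinuousAlternatingMap.smul_apply, smul_eq_mul]; ring
  have hf_off : ∀ x, x ∉ Q → f x = 0 := fun x hx ↦ by simp only [hf, hw_off x hx, zero_mul]
  have hfi : Integrable f μ := hfQ.integrable_of_forall_notMem_eq_zero hf_off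
  -- ### periodicity on the carrier
  have hcar' : ∀ m : K → ℤ, (fun x ↦ ComplexTorus.latticeVecOn Φ K m + x) ⁻¹' T.carrier = T.carrier :=
    fun m ↦ Set.ext fun x ↦ hcar _ x
  have hξ : ∀ (m : K → ℤ) (x : E), T.orientationFrame (ComplexTorus.latticeVecOn Φ K m + x) =
      T.orientationFrame x := fun m x ↦ T.orientationFrame_const_add (hcar' m) x
  have hdens' : ∀ (m : K → ℤ), ∀ x ∈ T.carrier,
      T.density (ComplexTorus.latticeVecOn Φ K m + x) = T.density x := fun m x hx ↦ hdens _ x hx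
  have hFper : ∀ (m : K → ℤ), ∀ x ∈ T.carrier, F (ComplexTorus.latticeVecOn Φ K m + x) = F x := by
    intro m x hx
    simp only [hF, hξ, hdens' m x hx]
  have haeD : ∀ᵐ x ∂(μ.restrict D), x ∈ T.carrier := ae_restrict_of_ae (ae_restrict_mem hcarm)
  have hxD : ∀ x ∈ D, ∀ k ∈ K, Φ.symm x k ∈ Ioo (-1 : ℝ) 2 := fun x hx k hk ↦
    ComplexTorus.mem_Ioo_of_mem_slab Φ K hx hk
  -- ### unfolding: `∫ f dμ = ∫_D F dμ`
  have hI : ∫ y, f y ∂μ = ∫ x in D, F x ∂μ := by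
    rw [ComplexTorus.integral_eq_sum_setIntegral_slab Φ K hfi (ComplexTorus.windowOn K)
      (fun m x hx h ↦ ComplexTorus.mem_windowOn_of_weight_ne_zero Φ K (hxD x hx) (left_ne_zero_of_mul h))]
    have hterm : ∀ m ∈ ComplexTorus.windowOn K,
        ∫ x in D, f (ComplexTorus.latticeVecOn Φ K m + x) ∂μ =
          ∫ x in D, w (ComplexTorus.latticeVecOn Φ K m + x) * F x ∂μ := by
      intro m _
      refine integral_congr_ae ?_
      filter_upwards [haeD] with x hx
      simp only [hf, hFper m x hx]
    rw [Finset.sum_congr rfl hterm]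
    have hint : ∀ m ∈ ComplexTorus.windowOn K,
        Integrable (fun x ↦ w (ComplexTorus.latticeVecOn Φ K m + x) * F x) (μ.restrict D) := fun m _ ↦
      hFD.bdd_mul ((ComplexTorus.contDiff_weight Φ K (n := 0)).continuous.comp
        (continuous_const.add continuous_id)).aestronglyMeasurable
        (ae_of_all _ fun x ↦ by
          rw [Real.norm_eq_abs]; exact ComplexTorus.abs_weight_le_one Φ K _)
    rw [← integral_finsetSum _ hint]
    refine setIntegral_congr_fun hDm fun x hx ↦ ?_
    rw [← Finset.sum_mul, ComplexTorus.sum_windowOn_weight Φ K (hxD x hx), one_mul]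
  rw [hRHS, hI, hD, hK, ComplexTorus.slab_univ_eq_periodBox_aux]

/-- **`∫_{T/Λ} φ = [T](w φ)` for real invariant forms**: the period functional of a `Λ`-periodic
holomorphic `p`-chain (`p = q + 1`) on a real constant form is the value of the current `[T]` on the
test form `χ φ`, `χ = w` the fundamental weight. [cite: VoisinHodgeI2002, §11.1.2 Cor. 11.15; Federer1969, 4.1.7] -/
theorem torusPeriod_ofReal_eq_toCurrent (T : HolomorphicChain 𝓘(ℂ, E) (⊤ : Opens E) (q + 1))
    (hcar : ∀ (m : ι → ℤ) (x : E), ComplexTorus.latticeVec Φ m + x ∈ T.carrier ↔ x ∈ T.carrier)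
    (hdens : ∀ (m : ι → ℤ), ∀ x ∈ T.carrier,
      T.density (ComplexTorus.latticeVec Φ m + x) = T.density x)
    (hχ : ∀ x, χ x = ComplexTorus.weight Φ Finset.univ x)
    (φ : E [⋀^Fin (2 * (q + 1))]→L[ℝ] ℝ) :
    T.torusPeriod Φ (ofRealCLM.compContinuousAlternatingMap φ) =
      ((T.toCurrent (smulCovectorCLM φ χ) : ℝ) : ℂ) := by
  rw [T.torusPeriod_ofReal Φ φ, T.setIntegral_periodBox_density_mul_eq_toCurrent Φ hcar hdens hχ φ]

/-- **`∫_{T/Λ} η = [T](w Re η) + i [T](w Im η)`** for every invariant form `η ∈ H^{2p}(X, ℂ)`.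
[cite: VoisinHodgeI2002, §11.1.2 Cor. 11.15; Federer1969, 4.1.7] -/
theorem torusPeriod_eq_toCurrent (T : HolomorphicChain 𝓘(ℂ, E) (⊤ : Opens E) (q + 1))
    (hcar : ∀ (m : ι → ℤ) (x : E), ComplexTorus.latticeVec Φ m + x ∈ T.carrier ↔ x ∈ T.carrier)
    (hdens : ∀ (m : ι → ℤ), ∀ x ∈ T.carrier,
      T.density (ComplexTorus.latticeVec Φ m + x) = T.density x)
    (hχ : ∀ x, χ x = ComplexTorus.weight Φ Finset.univ x)
    (η : E [⋀^Fin (2 * (q + 1))]→L[ℝ] ℂ) :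
    T.torusPeriod Φ η =
      ((T.toCurrent (smulCovectorCLM (reCLM.compContinuousAlternatingMap η) χ) : ℝ) : ℂ) +
        I * ((T.toCurrent (smulCovectorCLM (imCLM.compContinuousAlternatingMap η) χ) : ℝ) : ℂ) := by
  conv_lhs => rw [ComplexTorus.form_eq_re_add_im η]
  rw [map_add, map_smul, smul_eq_mul, T.torusPeriod_ofReal_eq_toCurrent Φ hcar hdens hχ,
    T.torusPeriod_ofReal_eq_toCurrent Φ hcar hdens hχ]

/-- The same for a `Λ`-periodic chain in the sense of `IsLatticePeriodic`.
[cite: VoisinHodgeI2002, §11.1.2 Cor. 11.15] -/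
theorem IsLatticePeriodic.torusPeriod_eq_toCurrent {T : HolomorphicChain 𝓘(ℂ, E) (⊤ : Opens E) (q + 1)}
    (hT : T.IsLatticePeriodic Φ) (hχ : ∀ x, χ x = ComplexTorus.weight Φ Finset.univ x)
    (η : E [⋀^Fin (2 * (q + 1))]→L[ℝ] ℂ) :
    T.torusPeriod Φ η =
      ((T.toCurrent (smulCovectorCLM (reCLM.compContinuousAlternatingMap η) χ) : ℝ) : ℂ) +
        I * ((T.toCurrent (smulCovectorCLM (imCLM.compContinuousAlternatingMap η) χ) : ℝ) : ℂ) :=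
  T.torusPeriod_eq_toCurrent Φ hT.mem_carrier_iff (fun m x _ ↦ hT.density_add m x) hχ η

/-! ## §3. Weak limits of periodic chains -/

section Convergence

variable (T : ℕ → HolomorphicChain 𝓘(ℂ, E) (⊤ : Opens E) (q + 1))

/-- **The periods converge along a sequence of periodic chains whose currents converge**: if the
`T_j` have `Λ`-periodic carriers and densities and `[T_j] → S` in the sense of currents, then for
every invariant form `η`, `∫_{T_j/Λ} η → S(w Re η) + i S(w Im η)` (`χ = w` the fundamental weight).
[cite: Fujiki1978, §2 Prop. 2.10; Chirka1989, §16.1, p. 206] -/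
theorem tendsto_torusPeriod_of_tendsto_current
    (hcar : ∀ j (m : ι → ℤ) (x : E), ComplexTorus.latticeVec Φ m + x ∈ (T j).carrier ↔ x ∈ (T j).carrier)
    (hdens : ∀ j (m : ι → ℤ), ∀ x ∈ (T j).carrier,
      (T j).density (ComplexTorus.latticeVec Φ m + x) = (T j).density x)
    (hχ : ∀ x, χ x = ComplexTorus.weight Φ Finset.univ x)
    {S : Current (⊤ : Opens E) (2 * (q + 1))}
    (hconv : ∀ ψ, Tendsto (fun j ↦ (T j).toCurrent ψ) atTop (𝓝 (S ψ)))
    (η : E [⋀^Fin (2 * (q + 1))]→L[ℝ] ℂ) :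
    Tendsto (fun j ↦ (T j).torusPeriod Φ η) atTop
      (𝓝 (((S (smulCovectorCLM (reCLM.compContinuousAlternatingMap η) χ) : ℝ) : ℂ) +
        I * ((S (smulCovectorCLM (imCLM.compContinuousAlternatingMap η) χ) : ℝ) : ℂ))) := by
  have hre := (continuous_ofReal.tendsto _).comp
    (hconv (smulCovectorCLM (reCLM.compContinuousAlternatingMap η) χ))
  have him := (continuous_ofReal.tendsto _).comp
    (hconv (smulCovectorCLM (imCLM.compContinuousAlternatingMap η) χ))
  refine (hre.add (him.const_mul I)).congr fun j ↦ ?_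
  simp only [Function.comp_apply]
  exact ((T j).torusPeriod_eq_toCurrent Φ (hcar j) (hdens j) hχ η).symm

omit χ in
/-- **Continuity of the period functional under weak convergence to a periodic chain**: if the
`T_j` and `T∞` have `Λ`-periodic carriers and densities and `[T_j] → [T∞]` in the sense of currents,
then `∫_{T_j/Λ} η → ∫_{T∞/Λ} η` for every invariant form `η`.
[cite: Fujiki1978, §2 Prop. 2.10; Chirka1989, §16.1, p. 206] -/
theorem tendsto_torusPeriod_of_tendsto
    (hcar : ∀ j (m : ι → ℤ) (x : E), ComplexTorus.latticeVec Φ m + x ∈ (T j).carrier ↔ x ∈ (T j).carrier)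
    (hdens : ∀ j (m : ι → ℤ), ∀ x ∈ (T j).carrier,
      (T j).density (ComplexTorus.latticeVec Φ m + x) = (T j).density x)
    {T' : HolomorphicChain 𝓘(ℂ, E) (⊤ : Opens E) (q + 1)}
    (hcar' : ∀ (m : ι → ℤ) (x : E), ComplexTorus.latticeVec Φ m + x ∈ T'.carrier ↔ x ∈ T'.carrier)
    (hdens' : ∀ (m : ι → ℤ), ∀ x ∈ T'.carrier, T'.density (ComplexTorus.latticeVec Φ m + x) = T'.density x)
    (hconv : ∀ ψ, Tendsto (fun j ↦ (T j).toCurrent ψ) atTop (𝓝 (T'.toCurrent ψ)))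
    (η : E [⋀^Fin (2 * (q + 1))]→L[ℝ] ℂ) :
    Tendsto (fun j ↦ (T j).torusPeriod Φ η) atTop (𝓝 (T'.torusPeriod Φ η)) := by
  obtain ⟨χ, hχ⟩ := ComplexTorus.exists_testFunction_eq_weight Φ
  rw [T'.torusPeriod_eq_toCurrent Φ hcar' hdens' hχ η]
  exact tendsto_torusPeriod_of_tendsto_current Φ T hcar hdens hχ hconv η

end Convergence

end PeriodAsCurrent

end HolomorphicChain

/-! ## §4. Analytic subsets of the torus -/

namespace ComplexTorus

section Analytic

variable {ι : Type*} [Fintype ι] [DecidableEq ι] {E : Type u} [NormedAddCommGroup E]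
  [InnerProductSpace ℂ E] [FiniteDimensional ℂ E] [MeasurableSpace E] [BorelSpace E]
  (Φ : (ι → ℝ) ≃L[ℝ] E) {d : ℕ} {χ : 𝓓((⊤ : Opens E), ℝ)}

omit [DecidableEq ι] [MeasurableSpace E] [BorelSpace E] in
/-- The carrier of `[π⁻¹ Z]` is `Λ`-periodic (cf. `latticeVec_add_mem_carrier_analyticChain_iff` of
`ComplexTorusAnalyticCycleClassSubtorusEmbedding.lean`; private copy to keep the imports light).
[cite: Lange2023AbelianVarietiesComplex, §1.1.4] -/
private theorem carrier_analyticChain_periodic {Z : Set (ComplexTorus Φ)}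
    (hZ : HasPureDim 𝓘(ℂ, E) Z d) (m : ι → ℤ) (x : E) :
    latticeVec Φ m + x ∈ (analyticChain Φ hZ).carrier ↔ x ∈ (analyticChain Φ hZ).carrier :=
  HolomorphicChain.carrier_ofSet_periodic Φ (hasPureDim_liftSet Φ hZ) (translateTop_preimage_liftSet Φ Z) m x

omit [DecidableEq ι] [MeasurableSpace E] [BorelSpace E] in
/-- The density of `[π⁻¹ Z]` is `Λ`-periodic on the carrier (it is `1` there).
[cite: Chirka1989, §14.1 Cor., p. 174] -/
theorem density_analyticChain_latticeVec_add {Z : Set (ComplexTorus Φ)} (hZ : HasPureDim 𝓘(ℂ, E) Z d)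
    (m : ι → ℤ) {x : E} (hx : x ∈ (analyticChain Φ hZ).carrier) :
    (analyticChain Φ hZ).density (latticeVec Φ m + x) = (analyticChain Φ hZ).density x := by
  unfold analyticChain at hx ⊢
  rw [HolomorphicChain.density_ofSet_of_mem_carrier _ hx, HolomorphicChain.density_ofSet_of_mem_carrier _
    ((carrier_analyticChain_periodic Φ hZ m x).2 hx)]

/-- **`∫_Z η = [π⁻¹ Z](w Re η) + i [π⁻¹ Z](w Im η)`**: the current of integration of an analytic
subset `Z ⊆ X` of pure dimension `p = d + 1` on an invariant form, as a value of the current of its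
lift (`χ = w` the fundamental weight). [cite: VoisinHodgeI2002, §11.1.2 Cor. 11.15; Federer1969, 4.1.7] -/
theorem analyticCyclePeriod_eq_toCurrent {Z : Set (ComplexTorus Φ)} (hZ : HasPureDim 𝓘(ℂ, E) Z (d + 1))
    (hχ : ∀ x, χ x = weight Φ Finset.univ x) (η : E [⋀^Fin (2 * (d + 1))]→L[ℝ] ℂ) :
    analyticCyclePeriod Φ hZ η =
      (((analyticChain Φ hZ).toCurrent (smulCovectorCLM (reCLM.compContinuousAlternatingMap η) χ) : ℝ) : ℂ) +
        I * (((analyticChain Φ hZ).toCurrent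
          (smulCovectorCLM (imCLM.compContinuousAlternatingMap η) χ) : ℝ) : ℂ) :=
  (analyticChain Φ hZ).torusPeriod_eq_toCurrent Φ (carrier_analyticChain_periodic Φ hZ)
    (fun m _ hx ↦ density_analyticChain_latticeVec_add Φ hZ m hx) hχ η

variable {Z : ℕ → Set (ComplexTorus Φ)} (hZ : ∀ j, HasPureDim 𝓘(ℂ, E) (Z j) (d + 1))

/-- **`∫_{Z_j} η` converges when `[π⁻¹ Z_j]` converges in the sense of currents**, to
`S(w Re η) + i S(w Im η)` for the limit current `S`. [cite: Fujiki1978, §2 Prop. 2.10; Chirka1989, §16.1, p. 206] -/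
theorem tendsto_analyticCyclePeriod_of_tendsto_current (hχ : ∀ x, χ x = weight Φ Finset.univ x)
    {S : Current (⊤ : Opens E) (2 * (d + 1))}
    (hconv : ∀ ψ, Tendsto (fun j ↦ (analyticChain Φ (hZ j)).toCurrent ψ) atTop (𝓝 (S ψ)))
    (η : E [⋀^Fin (2 * (d + 1))]→L[ℝ] ℂ) :
    Tendsto (fun j ↦ analyticCyclePeriod Φ (hZ j) η) atTop
      (𝓝 (((S (smulCovectorCLM (reCLM.compContinuousAlternatingMap η) χ) : ℝ) : ℂ) +
        I * ((S (smulCovectorCLM (imCLM.compContinuousAlternatingMap η) χ) : ℝ) : ℂ))) :=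
  HolomorphicChain.tendsto_torusPeriod_of_tendsto_current Φ (fun j ↦ analyticChain Φ (hZ j))
    (fun j ↦ carrier_analyticChain_periodic Φ (hZ j))
    (fun j m _ hx ↦ density_analyticChain_latticeVec_add Φ (hZ j) m hx) hχ hconv η

omit χ in
/-- **`∫_{Z_j} η → ∫_Z η`** when `[π⁻¹ Z_j] → [π⁻¹ Z]` in the sense of currents.
[cite: Fujiki1978, §2 Prop. 2.10; Chirka1989, §16.1, p. 206] -/
theorem tendsto_analyticCyclePeriod_of_tendsto {Z' : Set (ComplexTorus Φ)}
    (hZ' : HasPureDim 𝓘(ℂ, E) Z' (d + 1))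
    (hconv : ∀ ψ, Tendsto (fun j ↦ (analyticChain Φ (hZ j)).toCurrent ψ) atTop
      (𝓝 ((analyticChain Φ hZ').toCurrent ψ)))
    (η : E [⋀^Fin (2 * (d + 1))]→L[ℝ] ℂ) :
    Tendsto (fun j ↦ analyticCyclePeriod Φ (hZ j) η) atTop (𝓝 (analyticCyclePeriod Φ hZ' η)) := by
  obtain ⟨χ, hχ⟩ := exists_testFunction_eq_weight Φ
  rw [analyticCyclePeriod_eq_toCurrent Φ hZ' hχ η]
  exact tendsto_analyticCyclePeriod_of_tendsto_current Φ hZ hχ hconv η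

omit χ in
/-- **The pairings `⟨γ, [Z_j]⟩ → ⟨γ, [Z]⟩` converge** for every invariant `γ` when `[π⁻¹ Z_j] → [π⁻¹ Z]`
in the sense of currents (`⟨γ, [Z]⟩ = ∫_Z γ`). [cite: VoisinHodgeI2002, §11.1.2 Cor. 11.15; Fujiki1978, §2 Prop. 2.10] -/
theorem tendsto_poincarePairing_analyticCycleClass_of_tendsto {n k : ℕ} (e : Fin n ≃ ι)
    (h : 2 * (d + 1) + k = n) {Z' : Set (ComplexTorus Φ)} (hZ' : HasPureDim 𝓘(ℂ, E) Z' (d + 1))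
    (hconv : ∀ ψ, Tendsto (fun j ↦ (analyticChain Φ (hZ j)).toCurrent ψ) atTop
      (𝓝 ((analyticChain Φ hZ').toCurrent ψ)))
    (γ : E [⋀^Fin (2 * (d + 1))]→L[ℝ] ℂ) :
    Tendsto (fun j ↦ poincarePairing Φ e h γ (analyticCycleClass Φ e h (hZ j))) atTop
      (𝓝 (poincarePairing Φ e h γ (analyticCycleClass Φ e h hZ'))) := by
  simp only [poincarePairing_analyticCycleClass]
  exact tendsto_analyticCyclePeriod_of_tendsto Φ hZ hZ' hconv γ

end Analytic

end ComplexTorus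

end Literature.Geometry.Kaehler

end
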